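import Literature.NumberTheory.DiophantineGeometry.AbcStewartYu2001PlaceBoundsAnalysis
import Literature.Barriers.ABC.BakerMethodBoundsPlaceBoundsProofs
import Literature.Barriers.ABC.BakerMethodBoundsYuInput
import HarnessLib

/-!
# Stewart–Yu 2001, Theorem 2 from the place bounds, IV: the `P(z)`-form and the `max`-form from the `p ∣ z` place bound ALONE

`Literature/NumberTheory/DiophantineGeometry/AbcStewartYu2001MaxFormProofs.lean` — proofs companion
(theorems only; no definition, no named fact) of `AbcStewartYu2001.lean`.

Stewart–Yu 2001, Theorem 2 is typed (`stewartYu2001_thm2`) with `p′ = min{P(x), P(y), P(z)}` as in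
[cite: Gyory2008, p. 282 (1.3)] and [cite: Pasten2024, §1 (ii)]; P. Vojta's zbMATH review
[cite: VojtaZbl103611032, review text] prints the WEAKER sentence with
`P′ = max{P(a), P(b), P(c)}`. This file records what the weaker readings cost in the tree's
currency of PLACE BOUNDS (`Θ_{uv} = theta K u v 0 = K^{ω(uv)+1} ∏_{q ∣ uv} log q`,
`Y = log max{e, 2 log c}`):

* `StewartYu2001.log_lt_largestPrimeFactor_mul_of_padicPlaceBound` — from the `p ∣ c` place bound
  ALONE (`ν_p(c) log p < Θ_{ab} · (p / log p)(log p + Y)` for the primes of `c`, `ab > 1`), with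
  NO archimedean input and nothing at the primes of `a, b`:
  `log z < P(z) · G^{C log₃ G⋆ / log₂ G}` for every coprime positive `x + y = z`, `z > 2`;
* `StewartYu2001.maxForm_of_padicPlaceBound` — hence Vojta's sentence
  `z < exp(max{P(x), P(y), P(z)} · G^{C log₃ G⋆ / log₂ G})` from the same single place bound;
* `StewartYu2001.maxForm_of_thm2` — and, trivially, from the typed (`min`) fact;
* `StewartYu2001.log_lt_largestPrimeFactor_mul_of_yu2007`, `StewartYu2001.maxForm_of_yu2007` — the
  `p ∣ c` place bound is supplied by Yu 2007 over `ℚ` ALONE (the named fact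
  `Literature.Barriers.ABC.yu2007_padicLogForm_rat`, through the tree's
  `Dioph.thm328_rat_finite_of_yu`, `padicClause_of_thm328_finite`, `padic_bound_c₂`), so the
  `P(z)`- and `max`-forms of Theorem 2 rest on ONE named fact and no archimedean theory.

So the `max`/`P(z)` readings are `p`-adic-only statements (in the cell's ladder: they follow from
the `p`-adic cruxes alone), while the printed `min` statement also consumes an archimedean bound for
the member of least `P` when it is the smallest of the three (parts II–III). The deduction is the
`c`-route of the tree (`Literature.Barriers.ABC.log_lt_route_c_of_placeBounds`), the member step and
self-improvement of part II (private copies here), and `StewartYu2001.absorb` of part I.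

## References

* [StewartYu2001] C. L. Stewart, K. Yu, *On the abc conjecture, II*, Duke Math. J. 108 (2001),
  169–181 — Theorem 2.
* [VojtaZbl103611032] P. Vojta, zbMATH review Zbl 1036.11032 of [StewartYu2001] (the `max` sentence).
* [Gyory2008] K. Győry, Acta Arith. 133 (2008), 281–295 — p. 282 (1.3), p. 287 (3.12)–(3.13).
* [Pasten2024] H. Pasten, Invent. Math. 236 (2024), 373–385 — §1 (ii), §5 (the `p ∣ c` place).
-/

noncomputable section

open Finset Real
open Literature.Barriers.ABC
open Literature.NumberTheory.DiophantineGeometry.Dioph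
open Literature.NumberTheory.DiophantineGeometry.Pasten

namespace Literature.NumberTheory.DiophantineGeometry

namespace StewartYu2001

/-! ### Private copies of the plumbing of part II -/

/-- If `X < A · log max(e, 2X)` with `A ≥ 1`, then `X < 2A log(4A)`
(`log(2X) ≤ log(4A) + 2X/(4A) − 1`). [folklore] -/
private theorem lt_two_mul_log_of_lt {A X : ℝ} (hA : 1 ≤ A)
    (h : X < A * Real.log (max (Real.exp 1) (2 * X))) : X < 2 * A * Real.log (4 * A) := by
  have hA0 : 0 < A := by linarith
  have hlog4A : 1 ≤ Real.log (4 * A) := by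
    rw [← Real.log_exp 1]
    apply Real.log_le_log (Real.exp_pos 1)
    have := Real.exp_one_lt_d9
    linarith
  rcases le_or_gt (2 * X) (Real.exp 1) with hsmall | hbig
  · rw [max_eq_left hsmall, Real.log_exp] at h
    nlinarith [mul_le_mul_of_nonneg_left hlog4A hA0.le]
  · rw [max_eq_right hbig.le] at h
    have hu0 : 0 < 2 * X := lt_trans (Real.exp_pos 1) hbig
    have hkey : Real.log (2 * X) ≤ Real.log (4 * A) + 2 * X / (4 * A) - 1 := by
      have h1 := Real.log_le_sub_one_of_pos (show 0 < 2 * X / (4 * A) by positivity)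
      rw [Real.log_div hu0.ne' (by positivity)] at h1
      linarith
    have h2 : A * Real.log (2 * X) ≤ A * Real.log (4 * A) + X / 2 - A := by
      have h3 := mul_le_mul_of_nonneg_left hkey hA0.le
      have h4 : A * (Real.log (4 * A) + 2 * X / (4 * A) - 1) =
          A * Real.log (4 * A) + X / 2 - A := by
        field_simp
        ring
      linarith [h4]
    linarith

section Plumbing

variable {K : ℝ}

/-- `0 < log max(4, q)`. [folklore] -/
private theorem log_max_four_pos (q : ℕ) : 0 < Real.log ((max 4 q : ℕ) : ℝ) :=
  Real.log_pos (by exact_mod_cast lt_of_lt_of_le (by norm_num : 1 < 4) (le_max_left 4 q))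

/-- `1 ≤ log max(4, q)`. [folklore] -/
private theorem one_le_log_max_four (q : ℕ) : 1 ≤ Real.log ((max 4 q : ℕ) : ℝ) := by
  rw [← Real.log_exp 1]
  apply Real.log_le_log (Real.exp_pos 1)
  have h4 : (4 : ℝ) ≤ ((max 4 q : ℕ) : ℝ) := by exact_mod_cast le_max_left 4 q
  have := Real.exp_one_lt_d9
  linarith

/-- `Θ_{uv} = theta K u v 0 = K^{ω(uv)+1} ∏_{q ∣ uv} log q` is at most
`K^{ω(n)+1} ∏_{q ∣ n} log max(4, q)` whenever `uv ∣ n` (`u, v` coprime and non-zero, `n ≠ 0`,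
`K ≥ 1`). [folklore] -/
private theorem theta_zero_le (hK : 1 ≤ K) {u v n : ℕ} (hu : u ≠ 0) (hv : v ≠ 0) (huv : u.Coprime v)
    (hn : n ≠ 0) (hdvd : u * v ∣ n) :
    theta K u v 0 ≤
      K ^ (n.primeFactors.card + 1) * ∏ q ∈ n.primeFactors, Real.log ((max 4 q : ℕ) : ℝ) := by
  rw [theta_zero_eq K hu hv huv]
  have hsub : (u * v).primeFactors ⊆ n.primeFactors := Nat.primeFactors_mono hdvd hn
  have hK0 : 0 ≤ K := by linarith
  have h1 : K ^ ((u * v).primeFactors.card + 1) ≤ K ^ (n.primeFactors.card + 1) :=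
    pow_le_pow_right₀ hK (by have := Finset.card_le_card hsub; omega)
  have hlog0 : ∀ q ∈ (u * v).primeFactors, 0 ≤ Real.log (q : ℝ) := fun q hq =>
    Real.log_nonneg (by exact_mod_cast (Nat.prime_of_mem_primeFactors hq).one_lt.le)
  have h2 : ∏ q ∈ (u * v).primeFactors, Real.log (q : ℝ) ≤
      ∏ q ∈ (u * v).primeFactors, Real.log ((max 4 q : ℕ) : ℝ) := by
    apply Finset.prod_le_prod hlog0
    intro q hq
    have hq0 : (0 : ℝ) < q := by exact_mod_cast (Nat.prime_of_mem_primeFactors hq).pos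
    exact Real.log_le_log hq0 (by exact_mod_cast le_max_right 4 q)
  have h3 : ∏ q ∈ (u * v).primeFactors, Real.log ((max 4 q : ℕ) : ℝ) ≤
      ∏ q ∈ n.primeFactors, Real.log ((max 4 q : ℕ) : ℝ) :=
    Finset.prod_le_prod_of_subset_of_one_le hsub (fun q _ => (log_max_four_pos q).le)
      fun q _ _ => one_le_log_max_four q
  exact mul_le_mul h1 (h2.trans h3) (Finset.prod_nonneg hlog0) (pow_nonneg hK0 _)

/-- From a route output `X < Θ · Y · (1 + 3 ∑_{p ∣ u} p)` with `Θ ≤ M`, `M ≥ 0`, `Y ≥ 1` and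
`u ∣ n ≠ 0`: `X < M · Y · ((1 + 3 ω(n)) · P(u))` (`∑_{p ∣ u} p ≤ ω(u) P(u) ≤ ω(n) P(u)`,
`P(u) ≥ 1`). [folklore] -/
private theorem route_to_member {Θ M Y X : ℝ} {u n : ℕ}
    (hX : X < Θ * Y * (1 + 3 * ∑ p ∈ u.primeFactors, (p : ℝ)))
    (hΘM : Θ ≤ M) (hM : 0 ≤ M) (hY : 1 ≤ Y) (hn : n ≠ 0) (hun : u ∣ n) :
    X < M * Y * ((1 + 3 * (n.primeFactors.card : ℝ)) * largestPrimeFactor u) := by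
  have hsub : u.primeFactors ⊆ n.primeFactors := Nat.primeFactors_mono hun hn
  have hP1 : (1 : ℝ) ≤ largestPrimeFactor u := by exact_mod_cast one_le_largestPrimeFactor u
  have hsum : ∑ p ∈ u.primeFactors, (p : ℝ) ≤ n.primeFactors.card * largestPrimeFactor u := by
    have h1 : ∑ p ∈ u.primeFactors, (p : ℝ) ≤ u.primeFactors.card • (largestPrimeFactor u : ℝ) :=
      Finset.sum_le_card_nsmul _ _ _ fun p hp => by
        exact_mod_cast le_largestPrimeFactor_of_mem_primeFactors hp
    rw [nsmul_eq_mul] at h1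
    have h2 : (u.primeFactors.card : ℝ) ≤ n.primeFactors.card := by
      exact_mod_cast Finset.card_le_card hsub
    nlinarith
  have hS0 : 0 ≤ 1 + 3 * ∑ p ∈ u.primeFactors, (p : ℝ) := by positivity
  have h3 : 1 + 3 * ∑ p ∈ u.primeFactors, (p : ℝ) ≤
      (1 + 3 * (n.primeFactors.card : ℝ)) * largestPrimeFactor u := by
    nlinarith
  calc X < Θ * Y * (1 + 3 * ∑ p ∈ u.primeFactors, (p : ℝ)) := hX
    _ ≤ M * Y * (1 + 3 * ∑ p ∈ u.primeFactors, (p : ℝ)) :=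
        mul_le_mul_of_nonneg_right (mul_le_mul_of_nonneg_right hΘM (by linarith)) hS0
    _ ≤ M * Y * ((1 + 3 * (n.primeFactors.card : ℝ)) * largestPrimeFactor u) :=
        mul_le_mul_of_nonneg_left h3 (by positivity)

end Plumbing

/-! ### The `P(z)`-form from the `p ∣ z` place bound alone -/

/-- **`log z < P(z) · G^{C log₃ G⋆ / log₂ G}` from the `p ∣ z` place bound alone.** If for some
`K ≥ 1` every abc triple `(a, b, c)` with `ab > 1` satisfies
`ν_p(c) log p < Θ_{ab} · (p / log p)(log p + Y)` for every prime `p ∣ c`, then there is `C > 0`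
with `log c < P(c) · G^{thm2Exponent C G}` for every abc triple with `c > 2` (`G = rad(abc)`).
The `c`-route `log c < Θ_{ab} Y (1 + 3 ∑_{p ∣ c} p)` (`log_lt_route_c_of_placeBounds`),
`Θ_{ab} ≤ M`, `∑_{p ∣ c} p ≤ ω P(c)`, self-improvement and `absorb` — the member-`z` case of the
deduction of Theorem 2, which needs no archimedean estimate.
[cite: StewartYu2001, Theorem 2 (deduction, member z)] [cite: Pasten2024, §5] -/
theorem log_lt_largestPrimeFactor_mul_of_padicPlaceBound {K : ℝ} (hK : 1 ≤ K)
    (hpadc : ∀ {a b c : ℕ}, IsABCTriple a b c → 1 < a * b → ∀ {p : ℕ}, p.Prime → p ∣ c →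
      (c.factorization p : ℝ) * Real.log p < theta K a b 0 *
        ((p / Real.log p) * (Real.log p + Real.log (max (Real.exp 1) (2 * Real.log c))))) :
    ∃ C : ℝ, 0 < C ∧ ∀ a b c : ℕ, IsABCTriple a b c → 2 < c →
      Real.log c < largestPrimeFactor c * (rad a b c : ℝ) ^ thm2Exponent C (rad a b c) := by
  obtain ⟨C, hC, habs⟩ := absorb hK
  refine ⟨C, hC, fun a b c h hc => ?_⟩
  obtain ⟨ha, hb, habc, hcop⟩ := id h
  have hc0 : c ≠ 0 := by omega
  have habc0 : a * b * c ≠ 0 := by positivity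
  have hab : 1 < a * b := by
    by_contra hle
    push Not at hle
    have hab1 : a * b = 1 := by have := Nat.mul_pos ha hb; omega
    have ha1 := Nat.eq_one_of_mul_eq_one_right hab1
    have hb1 := Nat.eq_one_of_mul_eq_one_left hab1
    omega
  have hK0 : 0 < K := by linarith
  -- the `c`-route
  have hCc := log_lt_route_c_of_placeBounds hK h (hpadc h hab)
  set PL := ∏ q ∈ (a * b * c).primeFactors, Real.log ((max 4 q : ℕ) : ℝ) with hPLdef
  set M := K ^ ((a * b * c).primeFactors.card + 1) * PL with hMdef
  set Y := Real.log (max (Real.exp 1) (2 * Real.log c)) with hYdef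
  set L := Real.log (rad a b c : ℕ) with hLdef
  set T := 1 + 3 * ((a * b * c).primeFactors.card : ℝ) with hTdef
  set P : ℝ := (largestPrimeFactor c : ℝ) with hPdef
  have hPL1 : 1 ≤ PL := one_le_prod_log_max_four _
  have hM1 : 1 ≤ M := one_le_mul_of_one_le_of_one_le (one_le_pow₀ hK) hPL1
  have hMpos : 0 < M := by linarith
  have hY1 : 1 ≤ Y := one_le_log_max_exp _
  have hΘc : theta K a b 0 ≤ M := theta_zero_le hK ha.ne' hb.ne' hcop habc0 (Dvd.intro c rfl)
  have hmc : Real.log c < M * Y * (T * P) :=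
    route_to_member hCc hΘc hMpos.le hY1 habc0 (Dvd.intro_left (a * b) rfl)
  -- self-improvement with `A = M T P(c)`
  have hω1 : (1 : ℝ) ≤ (a * b * c).primeFactors.card := by
    have hab1 : 1 ≤ a * b := Nat.mul_pos ha hb
    have h1 : 1 < a * b * c :=
      lt_of_lt_of_le (by omega : 1 < c) (Nat.le_mul_of_pos_left c hab1)
    exact_mod_cast Finset.card_pos.mpr (Nat.nonempty_primeFactors.mpr h1)
  have hT4 : 4 ≤ T := by rw [hTdef]; linarith
  have hTpos : 0 < T := by linarith
  have hP1 : (1 : ℝ) ≤ P := by rw [hPdef]; exact_mod_cast one_le_largestPrimeFactor c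
  have hPpos : (0 : ℝ) < P := by linarith
  set A := M * T * P with hAdef
  have hA1 : 1 ≤ A :=
    one_le_mul_of_one_le_of_one_le (one_le_mul_of_one_le_of_one_le hM1 (by linarith)) hP1
  have hA0 : 0 < A := by linarith
  have hXA : Real.log c < A * Y := by
    have : A * Y = M * Y * (T * P) := by rw [hAdef]; ring
    rw [this]; exact hmc
  have hSI : Real.log c < 2 * A * Real.log (4 * A) := lt_two_mul_log_of_lt hA1 hXA
  -- `log(4A) ≤ 4MT − 1 + L` (`P(c) ≤ G`)
  have hrad6 : (6 : ℝ) ≤ (rad a b c : ℝ) := by exact_mod_cast six_le_rad h hc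
  have hL1 : 1 < L := by
    rw [hLdef, Real.lt_log_iff_exp_lt (by linarith)]
    have := Real.exp_one_lt_d9
    linarith
  have hPle : P ≤ (rad a b c : ℝ) := by
    have hcne : c.primeFactors.Nonempty := Nat.nonempty_primeFactors.mpr (by omega)
    have hPc := largestPrimeFactor_mem hcne
    have hPc' : largestPrimeFactor c ≤ rad a b c :=
      prime_le_rad (Nat.prime_of_mem_primeFactors hPc)
        ((Nat.dvd_of_mem_primeFactors hPc).trans (Dvd.intro_left (a * b) rfl)) habc0
    rw [hPdef]; exact_mod_cast hPc'
  have hlogP : Real.log P ≤ L := Real.log_le_log hPpos hPle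
  have hlog4A : Real.log (4 * A) ≤ 4 * M * T - 1 + L := by
    have hsplit : 4 * A = (4 * M * T) * P := by rw [hAdef]; ring
    have h47 : (0 : ℝ) < 4 * M * T := by positivity
    rw [hsplit, Real.log_mul h47.ne' hPpos.ne']
    have := Real.log_le_sub_one_of_pos h47
    linarith
  have hstep : 4 * M * T - 1 + L ≤ 4 * M * T * L := by
    have h0 : (1 : ℝ) * 4 ≤ M * T := mul_le_mul hM1 hT4 (by norm_num) hMpos.le
    have h1 : (1 : ℝ) ≤ 4 * M * T := by linarith
    linarith [mul_nonneg (sub_nonneg.mpr h1) (sub_nonneg.mpr hL1.le)]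
  have hT0 : 0 ≤ T := hTpos.le
  have hTω : T ≤ 4 * (a * b * c).primeFactors.card := by rw [hTdef]; linarith
  have hL0 : 0 ≤ L := by linarith
  have hcore : Real.log c < P * (128 * M ^ 2 * ((a * b * c).primeFactors.card : ℝ) ^ 2 * L) := by
    calc Real.log c < 2 * A * Real.log (4 * A) := hSI
      _ ≤ 2 * A * (4 * M * T * L) := mul_le_mul_of_nonneg_left (hlog4A.trans hstep) (by linarith)
      _ = P * (8 * M ^ 2 * T ^ 2 * L) := by rw [hAdef]; ring
      _ ≤ P * (8 * M ^ 2 * (4 * (a * b * c).primeFactors.card) ^ 2 * L) := by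
          apply mul_le_mul_of_nonneg_left _ hPpos.le
          apply mul_le_mul_of_nonneg_right _ hL0
          apply mul_le_mul_of_nonneg_left _ (by positivity)
          exact pow_le_pow_left₀ hT0 hTω 2
      _ = P * (128 * M ^ 2 * ((a * b * c).primeFactors.card : ℝ) ^ 2 * L) := by ring
  -- absorption
  have hrad : ((rad a b c : ℕ) : ℝ) = ∏ q ∈ (a * b * c).primeFactors, (q : ℝ) := by
    rw [rad_def, Nat.radical_eq_prod_primeFactors]; push_cast; rfl
  have h6 : (6 : ℝ) ≤ ∏ q ∈ (a * b * c).primeFactors, (q : ℝ) := by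
    rw [← hrad]; exact_mod_cast six_le_rad h hc
  have hQ := habs _ (fun q hq => Nat.prime_of_mem_primeFactors hq) h6
  rw [← hrad] at hQ
  exact hcore.trans_le (mul_le_mul_of_nonneg_left hQ hPpos.le)

/-- **Vojta's sentence from the `p ∣ z` place bound alone:** under the hypothesis of
`log_lt_largestPrimeFactor_mul_of_padicPlaceBound` there is `C > 0` with
`z < exp(max{P(x), P(y), P(z)} · G^{C log₃ G⋆ / log₂ G})` for all coprime positive `x + y = z`,
`z > 2` (`P(z) ≤ max`). [cite: VojtaZbl103611032, review text]
[cite: StewartYu2001, Theorem 2 (weak form)] -/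
theorem maxForm_of_padicPlaceBound {K : ℝ} (hK : 1 ≤ K)
    (hpadc : ∀ {a b c : ℕ}, IsABCTriple a b c → 1 < a * b → ∀ {p : ℕ}, p.Prime → p ∣ c →
      (c.factorization p : ℝ) * Real.log p < theta K a b 0 *
        ((p / Real.log p) * (Real.log p + Real.log (max (Real.exp 1) (2 * Real.log c))))) :
    ∃ C : ℝ, 0 < C ∧ ∀ x y z : ℕ, IsABCTriple x y z → 2 < z →
      (z : ℝ) < Real.exp
        ((max (largestPrimeFactor x) (max (largestPrimeFactor y) (largestPrimeFactor z)) : ℕ) *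
          (rad x y z : ℝ) ^ thm2Exponent C (rad x y z)) := by
  obtain ⟨C, hC, hb⟩ := log_lt_largestPrimeFactor_mul_of_padicPlaceBound hK hpadc
  refine ⟨C, hC, fun x y z h hz => ?_⟩
  have hz0 : (0 : ℝ) < z := by exact_mod_cast lt_trans two_pos hz
  rw [← Real.log_lt_iff_lt_exp hz0]
  have h1 := hb x y z h hz
  have hR : (6 : ℝ) ≤ (rad x y z : ℝ) := by exact_mod_cast six_le_rad h hz
  have hpow : 0 ≤ (rad x y z : ℝ) ^ thm2Exponent C (rad x y z) :=
    Real.rpow_nonneg (by linarith) _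
  have hle : (largestPrimeFactor z : ℝ) ≤
      ((max (largestPrimeFactor x) (max (largestPrimeFactor y) (largestPrimeFactor z)) : ℕ) : ℝ) := by
    exact_mod_cast (le_max_right _ _).trans (le_max_right _ _)
  exact h1.trans_le (mul_le_mul_of_nonneg_right hle hpow)

/-- The typed (`min`) Theorem 2 implies Vojta's `max` sentence (`min ≤ max`; the bound is
non-negative). [cite: VojtaZbl103611032, review text] [cite: StewartYu2001, Theorem 2] -/
theorem maxForm_of_thm2 (hSY : stewartYu2001_thm2) :
    ∃ C : ℝ, 0 < C ∧ ∀ x y z : ℕ, IsABCTriple x y z → 2 < z →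
      (z : ℝ) < Real.exp
        ((max (largestPrimeFactor x) (max (largestPrimeFactor y) (largestPrimeFactor z)) : ℕ) *
          (rad x y z : ℝ) ^ thm2Exponent C (rad x y z)) := by
  obtain ⟨C, hC, hb⟩ := stewartYu2001_thm2_iff.mp hSY
  refine ⟨C, hC, fun x y z h hz => ?_⟩
  have h1 := hb x y z h hz
  have hR : (6 : ℝ) ≤ (rad x y z : ℝ) := by exact_mod_cast six_le_rad h hz
  have hpow : 0 ≤ (rad x y z : ℝ) ^ thm2Exponent C (rad x y z) :=
    Real.rpow_nonneg (by linarith) _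
  have hle : (pmin x y z : ℝ) ≤
      ((max (largestPrimeFactor x) (max (largestPrimeFactor y) (largestPrimeFactor z)) : ℕ) : ℝ) := by
    rw [pmin_def]
    exact_mod_cast (min_le_left _ _).trans (le_max_left _ _)
  exact h1.trans_le (Real.exp_le_exp.mpr (mul_le_mul_of_nonneg_right hle hpow))

/-! ### … and from Yu 2007 over `ℚ` alone -/

/-- **`log z < P(z) · G^{C log₃ G⋆ / log₂ G}` from Yu's `p`-adic theorem over `ℚ` alone** (the
named fact `yu2007_padicLogForm_rat` = Evertse–Győry Thm 3.2.7 for `K = ℚ`): the `p ∣ c` place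
bound at threshold `0` with `K = pastenK` is `padic_bound_c₂` of the `p`-adic clause
`padicClause_of_thm328_finite (Dioph.thm328_rat_finite_of_yu hY)`. No archimedean estimate and no
Kummer theory enter. [cite: StewartYu2001, Theorem 2 (deduction, member z)]
[cite: EvertseGyory2015, Thm 3.2.7 (p. 62)] -/
theorem log_lt_largestPrimeFactor_mul_of_yu2007 (hY : yu2007_padicLogForm_rat) :
    ∃ C : ℝ, 0 < C ∧ ∀ a b c : ℕ, IsABCTriple a b c → 2 < c →
      Real.log c < largestPrimeFactor c * (rad a b c : ℝ) ^ thm2Exponent C (rad a b c) :=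
  log_lt_largestPrimeFactor_mul_of_padicPlaceBound one_le_pastenK
    (fun h h1 => fun hp hpc =>
      padic_bound_c₂ one_le_pastenK (padicClause_of_thm328_finite (thm328_rat_finite_of_yu hY))
        h h1 0 hp hpc)

/-- **Vojta's `max` sentence for Theorem 2 from Yu 2007 over `ℚ` alone:** there is `C > 0` with
`z < exp(max{P(x), P(y), P(z)} · G^{C log₃ G⋆ / log₂ G})` for all coprime positive `x + y = z`,
`z > 2`, conditionally on the single named fact `yu2007_padicLogForm_rat`.
[cite: VojtaZbl103611032, review text] [cite: StewartYu2001, Theorem 2 (weak form)]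
[cite: EvertseGyory2015, Thm 3.2.7 (p. 62)] -/
theorem maxForm_of_yu2007 (hY : yu2007_padicLogForm_rat) :
    ∃ C : ℝ, 0 < C ∧ ∀ x y z : ℕ, IsABCTriple x y z → 2 < z →
      (z : ℝ) < Real.exp
        ((max (largestPrimeFactor x) (max (largestPrimeFactor y) (largestPrimeFactor z)) : ℕ) *
          (rad x y z : ℝ) ^ thm2Exponent C (rad x y z)) :=
  maxForm_of_padicPlaceBound one_le_pastenK
    (fun h h1 => fun hp hpc =>
      padic_bound_c₂ one_le_pastenK (padicClause_of_thm328_finite (thm328_rat_finite_of_yu hY))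
        h h1 0 hp hpc)

end StewartYu2001

end Literature.NumberTheory.DiophantineGeometry

end
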